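import Literature.NumberTheory.LFunctions.LiouvilleWalshVaughan
import Literature.NumberTheory.LFunctions.MoebiusWalshBoxCriterion
import HarnessLib

/-!
# Liouville–Walsh sums: from per-box bounds to the Walsh sum (Bourgain 2013, §3 bookkeeping, for `λ`) — proved

Topic `Literature/NumberTheory/LFunctions`, proofs companion of `MoebiusWalshCircuits.lean`
(named fact `bourgain_liouville_walsh_uniform`: J. Bourgain, *Möbius–Walsh correlation bounds and
an estimate of Mauduit and Rivat*, J. Anal. Math. 119 (2013) 147–163 = arXiv:1109.2784,
Theorem 1, parenthesis "(a similar estimate is also valid for the Liouville function)").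
Everything here is PROVED (theorems only; no definition, no named fact).

This is the Liouville twin of `MoebiusWalshBoxCriterion.lean`
(`MoebiusWalsh.abs_walshSum_moebius_le_of_boxBounds`), sitting on top of the Liouville Vaughan
reduction `LiouvilleWalshVaughan.abs_walshSum_liouville_le_boxes` exactly as the Möbius criterion
sits on `MoebiusWalshVaughan.abs_walshSum_moebius_le_boxes`: if every LARGE dyadic box
(`i + j < n ≤ i + j + s₀`) satisfies `|box_I(T)| ≤ E_I` and `|box_II(T)| ≤ E_II` for both digit sets
`T ∈ {S, S ∪ {n}}`, then

  `|walshSum λ A| ≤ u + ⌊√2ⁿ⌋u + n²(E_I + 2^{n-s₀}(n+1)) + B n²(E_II + 2^{n-s₀}) + 2ⁿ(n+1)⁴/B`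

(`abs_walshSum_liouville_le_of_boxBounds`). Here `box_I(T) = boxSum T i j (liouvTypeICoeff u) 1`
(coefficient `λ_u * μ_u`, `|·| ≤ τ`) and `box_II(T) = boxSum T i j (typeIICoeffA u B) (liouvTypeIICoeffB u)`
(`|·| ≤ 1`). Since the analytic per-box estimates of the paper (§2 type II: any coefficients of
modulus `≤ 1`; §3 type I: the coefficient enters only through `|c| ≤ τ`) do not see WHICH
coefficient sequences occur, the small-box bounds and the removal of the type-I coefficient are
proved here for ARBITRARY coefficient sequences in the relevant class:

* `abs_boxSum_le_of_divisorBounded` — `|boxSum T i j c 1| ≤ 2^{i+j+1}(1 + log 2^{i+1})` for `|c| ≤ τ`;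
* `abs_boxSum_le_of_abs_le_one` — `|boxSum T i j α β| ≤ 2^{i+j}` for `|α|, |β| ≤ 1`;
* `abs_boxSum_le_sqrt_of_divisorBounded` — Cauchy–Schwarz removal of a divisor-bounded
  coefficient against a bound `F` for `∑_{a ∈ D_i} |∑_{b ∈ D_j} w_T(ab)|`:
  `|boxSum T i j c 1| ≤ √(2^{i+1}(1 + log 2^{i+1})³) √(2^j F)` (the generic form of
  `MoebiusWalsh.abs_boxSum_typeI_le`, tree's `∑_{a ≤ Z} τ(a)² ≤ Z(1 + log Z)³`),
so that the type-I estimates of `MoebiusWalshTypeIEstimate.lean` (`typeI_master`, …, which bound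
`∑_a |∑_b w_T(ab)|`) serve `λ` verbatim.

## References

* J. Bourgain, J. Anal. Math. 119 (2013) 147–163; arXiv:1109.2784, Theorem 1 (Liouville
  parenthesis), §3 (reduction to (2.1), (3.1)) and (3.10). [Bourgain2013MoebiusWalsh]
-/

noncomputable section

open Finset Real ArithmeticFunction
open scoped ArithmeticFunction.sigma

namespace Literature.NumberTheory.LFunctions.LiouvilleWalsh

open Literature.NumberTheory.LFunctions.MoebiusWalshVaughan (natWalsh dyBlock mem_dyBlock boxSum
  abs_boxSum_le abs_natWalsh abs_natWalsh_le typeIICoeffA abs_typeIICoeffA_le)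
open Literature.NumberTheory.LFunctions.LiouvilleWalshVaughan (liouvTypeICoeff abs_liouvTypeICoeff_le
  liouvTypeIICoeffB abs_liouvTypeIICoeffB_le abs_walshSum_liouville_le_boxes)
open Literature.NumberTheory.LFunctions.MoebiusWalsh (sum_dyBlock_card_divisors_le sum_boxes_le)

/-! ### Box bounds for arbitrary coefficients in the two classes -/

/-- **Trivial bound for a box with a divisor-bounded coefficient**: for `|c| ≤ τ`,
`|boxSum T i j c 1| ≤ 2^{i+j+1}(1 + log 2^{i+1})`. [folklore] -/
theorem abs_boxSum_le_of_divisorBounded (T : Finset ℕ) (i j : ℕ) {c : ℕ → ℝ}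
    (hc : ∀ a, |c a| ≤ (σ 0 a : ℝ)) :
    |boxSum T i j c (fun _ => 1)| ≤ 2 ^ (i + j + 1) * (1 + Real.log (2 ^ (i + 1))) := by
  refine (abs_boxSum_le T i j c (fun _ => 1) (fun _ => by simp)).trans ?_
  calc (∑ a ∈ dyBlock i, |c a|) * 2 ^ j
      ≤ (2 ^ (i + 1) * (1 + Real.log (2 ^ (i + 1)))) * 2 ^ j := by
        gcongr
        refine (Finset.sum_le_sum fun a _ => hc a).trans ?_
        have h := sum_dyBlock_card_divisors_le i
        refine le_trans (le_of_eq (Finset.sum_congr rfl fun a _ => ?_)) h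
        norm_cast
    _ = 2 ^ (i + j + 1) * (1 + Real.log (2 ^ (i + 1))) := by ring

/-- **Trivial bound for a box with coefficients of modulus `≤ 1`**: `|boxSum T i j α β| ≤ 2^{i+j}`.
[folklore] -/
theorem abs_boxSum_le_of_abs_le_one (T : Finset ℕ) (i j : ℕ) {α β : ℕ → ℝ}
    (hα : ∀ a, |α a| ≤ 1) (hβ : ∀ b, |β b| ≤ 1) : |boxSum T i j α β| ≤ 2 ^ (i + j) := by
  refine (abs_boxSum_le T i j α β hβ).trans ?_
  have hcard : ((dyBlock i).card : ℝ) = 2 ^ i := by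
    have h : 2 ^ (i + 1) - 2 ^ i = 2 ^ i := by rw [pow_succ]; omega
    rw [dyBlock, Nat.card_Ico, h]; push_cast; ring
  calc (∑ a ∈ dyBlock i, |α a|) * 2 ^ j ≤ (∑ _a ∈ dyBlock i, (1 : ℝ)) * 2 ^ j := by
        gcongr with a _
        exact hα a
    _ = 2 ^ (i + j) := by rw [Finset.sum_const, nsmul_eq_mul, mul_one, hcard, pow_add]

/-- **Removing a divisor-bounded coefficient by Cauchy–Schwarz**: for `|c| ≤ τ` and any bound
`∑_{a ∈ D_i} |∑_{b ∈ D_j} w_T(ab)| ≤ F`,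
`|boxSum T i j c 1| ≤ √(2^{i+1}(1 + log 2^{i+1})³) · √(2^j F)`
(`∑_{a ≤ 2^{i+1}} τ(a)² ≤ 2^{i+1}(1 + log 2^{i+1})³`, tree). The generic form of
`MoebiusWalsh.abs_boxSum_typeI_le`. [cite: Bourgain2013MoebiusWalsh, §3 (3.1)] -/
theorem abs_boxSum_le_sqrt_of_divisorBounded (T : Finset ℕ) (i j : ℕ) {c : ℕ → ℝ}
    (hc : ∀ a, |c a| ≤ (σ 0 a : ℝ)) {F : ℝ}
    (hF : ∑ a ∈ dyBlock i, |∑ b ∈ dyBlock j, natWalsh T (a * b)| ≤ F) :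
    |boxSum T i j c (fun _ => 1)| ≤
      Real.sqrt (2 ^ (i + 1) * (1 + Real.log (2 ^ (i + 1))) ^ 3) * Real.sqrt (2 ^ j * F) := by
  set G : ℕ → ℝ := fun a => ∑ b ∈ dyBlock j, natWalsh T (a * b) with hG
  have hbox : boxSum T i j c (fun _ => 1) = ∑ a ∈ dyBlock i, c a * G a := by
    unfold boxSum
    refine Finset.sum_congr rfl fun a _ => ?_
    rw [hG, Finset.mul_sum]
    refine Finset.sum_congr rfl fun b _ => ?_
    ring
  have hGle : ∀ a, |G a| ≤ 2 ^ j := by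
    intro a
    calc |G a| ≤ ∑ b ∈ dyBlock j, |natWalsh T (a * b)| := Finset.abs_sum_le_sum_abs _ _
      _ ≤ ∑ _b ∈ dyBlock j, (1 : ℝ) := Finset.sum_le_sum fun b _ => abs_natWalsh_le T _
      _ = 2 ^ j := by
          have : 2 ^ (j + 1) - 2 ^ j = 2 ^ j := by rw [pow_succ]; omega
          rw [Finset.sum_const, dyBlock, Nat.card_Ico, this]; simp
  -- Cauchy–Schwarz
  have hCS : (∑ a ∈ dyBlock i, |c a| * |G a|) ^ 2 ≤
      (∑ a ∈ dyBlock i, |c a| ^ 2) * ∑ a ∈ dyBlock i, |G a| ^ 2 :=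
    Finset.sum_mul_sq_le_sq_mul_sq _ _ _
  -- the divisor mean square
  have hτ : ∑ a ∈ dyBlock i, |c a| ^ 2 ≤ 2 ^ (i + 1) * (1 + Real.log (2 ^ (i + 1))) ^ 3 := by
    calc ∑ a ∈ dyBlock i, |c a| ^ 2
        ≤ ∑ a ∈ dyBlock i, ((Nat.card (Nat.divisors a) : ℕ) : ℝ) ^ 2 := by
          refine Finset.sum_le_sum fun a _ => ?_
          have h1 := hc a
          rw [ArithmeticFunction.sigma_zero_apply] at h1
          rw [Nat.card_eq_finsetCard]
          exact pow_le_pow_left₀ (abs_nonneg _) h1 2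
      _ ≤ ∑ a ∈ Ioc 0 (2 ^ (i + 1)), ((Nat.card (Nat.divisors a) : ℕ) : ℝ) ^ 2 := by
          refine Finset.sum_le_sum_of_subset_of_nonneg ?_ fun a _ _ => by positivity
          intro a ha
          rw [mem_dyBlock] at ha
          rw [Finset.mem_Ioc]
          have := Nat.two_pow_pos i
          omega
      _ ≤ (2 ^ (i + 1) : ℕ) * (1 + Real.log (2 ^ (i + 1) : ℕ)) ^ 3 := by
          have h := Literature.NumberTheory.Sieve.Vaughan.sum_sq_card_divisors_le (2 ^ (i + 1))
          simp only [Nat.card_eq_finsetCard]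
          exact h
      _ = 2 ^ (i + 1) * (1 + Real.log (2 ^ (i + 1))) ^ 3 := by push_cast; ring
  have hG2 : ∑ a ∈ dyBlock i, |G a| ^ 2 ≤ 2 ^ j * F := by
    calc ∑ a ∈ dyBlock i, |G a| ^ 2 ≤ ∑ a ∈ dyBlock i, 2 ^ j * |G a| := by
          refine Finset.sum_le_sum fun a _ => ?_
          rw [sq]
          exact mul_le_mul_of_nonneg_right (hGle a) (abs_nonneg _)
      _ = 2 ^ j * ∑ a ∈ dyBlock i, |G a| := by rw [Finset.mul_sum]
      _ ≤ 2 ^ j * F := by gcongr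
  have hlhs : |boxSum T i j c (fun _ => 1)| ≤ ∑ a ∈ dyBlock i, |c a| * |G a| := by
    rw [hbox]
    refine (Finset.abs_sum_le_sum_abs _ _).trans ?_
    refine Finset.sum_le_sum fun a _ => ?_
    rw [abs_mul]
  have hnonneg : 0 ≤ ∑ a ∈ dyBlock i, |c a| * |G a| :=
    Finset.sum_nonneg fun a _ => by positivity
  have hlog : 0 ≤ 1 + Real.log ((2 : ℝ) ^ (i + 1)) := by
    have := Real.log_nonneg (one_le_pow₀ (M₀ := ℝ) one_le_two (n := i + 1)); linarith
  have hconst : 0 ≤ (2 : ℝ) ^ (i + 1) * (1 + Real.log (2 ^ (i + 1))) ^ 3 :=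
    mul_nonneg (by positivity) (pow_nonneg hlog 3)
  refine hlhs.trans ?_
  rw [← Real.sqrt_mul hconst, ← Real.sqrt_sq hnonneg]
  refine Real.sqrt_le_sqrt ?_
  calc (∑ a ∈ dyBlock i, |c a| * |G a|) ^ 2
      ≤ (∑ a ∈ dyBlock i, |c a| ^ 2) * ∑ a ∈ dyBlock i, |G a| ^ 2 := hCS
    _ ≤ (2 ^ (i + 1) * (1 + Real.log (2 ^ (i + 1))) ^ 3) * (2 ^ j * F) := by
        refine mul_le_mul hτ hG2 (Finset.sum_nonneg fun a _ => by positivity) hconst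

/-! ### The criterion for `λ` -/

/-- **From per-box bounds on the large boxes to the Liouville–Walsh sum.** Let `S = A.map val`
and `u, B ≥ 1, s₀` be given. If for both digit sets `T ∈ {S, S ∪ {n}}` and every LARGE box
`i + j < n ≤ i + j + s₀` one has `|boxSum T i j (liouvTypeICoeff u) 1| ≤ E_I` and
`|boxSum T i j (typeIICoeffA u B) (liouvTypeIICoeffB u)| ≤ E_II` (`E_I, E_II ≥ 0`), then

  `|walshSum λ A| ≤ u + ⌊√2ⁿ⌋u + n²(E_I + 2^{n-s₀}(n+1)) + B n²(E_II + 2^{n-s₀}) + 2ⁿ(n+1)⁴/B`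

(the Vaughan reduction `abs_walshSum_liouville_le_boxes`, the trivial bounds on the small
boxes, `1 + log 2^{i+1} ≤ n + 1`). The Liouville twin of
`MoebiusWalsh.abs_walshSum_moebius_le_of_boxBounds`.
[cite: Bourgain2013MoebiusWalsh, Theorem 1 (remark on λ), §3 (reduction to (2.1), (3.1)) and (3.10)] -/
theorem abs_walshSum_liouville_le_of_boxBounds (n u B s₀ : ℕ) (hB : 1 ≤ B) (A : Finset (Fin n))
    {EI EII : ℝ} (hEI : 0 ≤ EI) (hEII : 0 ≤ EII)
    (hI : ∀ T : Finset ℕ, (T = A.map Fin.valEmbedding ∨ T = insert n (A.map Fin.valEmbedding)) →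
      ∀ i j : ℕ, i + j < n → n ≤ i + j + s₀ → |boxSum T i j (liouvTypeICoeff u) (fun _ => 1)| ≤ EI)
    (hII : ∀ T : Finset ℕ, (T = A.map Fin.valEmbedding ∨ T = insert n (A.map Fin.valEmbedding)) →
      ∀ i j : ℕ, i + j < n → n ≤ i + j + s₀ →
        |boxSum T i j (typeIICoeffA u B) (liouvTypeIICoeffB u)| ≤ EII) :
    |walshSum (fun m => (ArithmeticFunction.liouville m : ℤ)) A| ≤
      (u + (Nat.sqrt (2 ^ n) : ℝ) * u) + (n : ℝ) ^ 2 * (EI + 2 ^ (n - s₀) * (n + 1)) +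
        B * ((n : ℝ) ^ 2 * (EII + 2 ^ (n - s₀))) + 2 ^ n * ((n : ℝ) + 1) ^ 4 / B := by
  set S : Finset ℕ := A.map Fin.valEmbedding with hS
  have hlog : ∀ i : ℕ, i < n → 1 + Real.log ((2 : ℝ) ^ (i + 1)) ≤ n + 1 := by
    intro i hi
    rw [Real.log_pow]
    have h2 : Real.log 2 ≤ 1 := by
      have := Real.log_two_lt_d9; linarith
    have h3 : ((i + 1 : ℕ) : ℝ) * Real.log 2 ≤ (i + 1 : ℕ) := by
      have := mul_le_mul_of_nonneg_left h2 (Nat.cast_nonneg (i + 1)); simpa using this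
    have h4 : ((i + 1 : ℕ) : ℝ) ≤ n := by exact_mod_cast hi
    linarith
  have hlog0 : ∀ i : ℕ, 0 ≤ 1 + Real.log ((2 : ℝ) ^ (i + 1)) := fun i => by
    have := Real.log_nonneg (one_le_pow₀ (M₀ := ℝ) one_le_two (n := i + 1)); linarith
  -- small boxes
  have hsmallI : ∀ T : Finset ℕ, ∀ i j : ℕ, i + j < n → i + j + s₀ < n →
      |boxSum T i j (liouvTypeICoeff u) (fun _ => 1)| ≤ 2 ^ (n - s₀) * (n + 1) := by
    intro T i j hij hsm
    refine (abs_boxSum_le_of_divisorBounded T i j (abs_liouvTypeICoeff_le u)).trans ?_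
    have h1 : (2 : ℝ) ^ (i + j + 1) ≤ 2 ^ (n - s₀) := pow_le_pow_right₀ one_le_two (by omega)
    exact mul_le_mul h1 (hlog i (by omega)) (hlog0 i) (by positivity)
  have hsmallII : ∀ T : Finset ℕ, ∀ i j : ℕ, i + j < n → i + j + s₀ < n →
      |boxSum T i j (typeIICoeffA u B) (liouvTypeIICoeffB u)| ≤ 2 ^ (n - s₀) := by
    intro T i j hij hsm
    refine (abs_boxSum_le_of_abs_le_one T i j (abs_typeIICoeffA_le hB u)
      (abs_liouvTypeIICoeffB_le u)).trans ?_
    exact pow_le_pow_right₀ one_le_two (by omega)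
  -- the two double sums
  have hsumI : ∑ i ∈ range n, ∑ j ∈ range (n - i),
      (|boxSum S i j (liouvTypeICoeff u) (fun _ => 1)| +
        |boxSum (insert n S) i j (liouvTypeICoeff u) (fun _ => 1)|) ≤
      (n : ℝ) ^ 2 * (2 * EI + 2 * (2 ^ (n - s₀) * (n + 1))) := by
    refine sum_boxes_le (n := n) (s₀ := s₀) (by positivity) (by positivity) ?_ ?_
    · intro i j hij hl
      have h1 := hI S (Or.inl rfl) i j hij hl
      have h2 := hI (insert n S) (Or.inr rfl) i j hij hl
      linarith
    · intro i j hij hs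
      have h1 := hsmallI S i j hij hs
      have h2 := hsmallI (insert n S) i j hij hs
      linarith
  have hsumII : ∑ i ∈ range n, ∑ j ∈ range (n - i),
      (|boxSum S i j (typeIICoeffA u B) (liouvTypeIICoeffB u)| +
        |boxSum (insert n S) i j (typeIICoeffA u B) (liouvTypeIICoeffB u)|) ≤
      (n : ℝ) ^ 2 * (2 * EII + 2 * 2 ^ (n - s₀)) := by
    refine sum_boxes_le (n := n) (s₀ := s₀) (by positivity) (by positivity) ?_ ?_
    · intro i j hij hl
      have h1 := hII S (Or.inl rfl) i j hij hl
      have h2 := hII (insert n S) (Or.inr rfl) i j hij hl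
      linarith
    · intro i j hij hs
      have h1 := hsmallII S i j hij hs
      have h2 := hsmallII (insert n S) i j hij hs
      linarith
  have hB0 : (0 : ℝ) ≤ B := by positivity
  have hmain := abs_walshSum_liouville_le_boxes n u B hB A
  rw [← hS] at hmain
  calc |walshSum (fun m => (ArithmeticFunction.liouville m : ℤ)) A| ≤ _ := hmain
    _ ≤ (u + (Nat.sqrt (2 ^ n) : ℝ) * u) +
          (1 / 2) * ((n : ℝ) ^ 2 * (2 * EI + 2 * (2 ^ (n - s₀) * (n + 1)))) +
          (B / 2) * ((n : ℝ) ^ 2 * (2 * EII + 2 * 2 ^ (n - s₀))) + 2 ^ n * ((n : ℝ) + 1) ^ 4 / B := by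
        gcongr
    _ = (u + (Nat.sqrt (2 ^ n) : ℝ) * u) + (n : ℝ) ^ 2 * (EI + 2 ^ (n - s₀) * (n + 1)) +
          B * ((n : ℝ) ^ 2 * (EII + 2 ^ (n - s₀))) + 2 ^ n * ((n : ℝ) + 1) ^ 4 / B := by
        ring

end Literature.NumberTheory.LFunctions.LiouvilleWalsh
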